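import Summits.ABC.ABC.Theses.DefiniteXi
import Literature.NumberTheory.EllipticCurves.GlobalMinimalModel
import Literature.NumberTheory.EllipticCurves.Szpiro
import Literature.NumberTheory.EllipticCurves.DegreeConjectureAbcMurtyProofs
import Literature.NumberTheory.DiophantineApproximation.SparseDyadicRationals
import HarnessLib

/-!
# Crux `DefiniteXi.DefiniteRTControlPrime` (stmt-ABC-11338), line `Sketch`: stub `stub_freyScale`

The registered stub `stub_freyScale` of the lead skeleton
(`Cruxes/DefiniteRTControlPrime/Lines/Sketch.lean`), verbatim: if a change of variables `C` over
`ℚ` takes the Frey model `E_(a,b) : y² = x(x − a)(x + b)` (`a, b` coprime, `ab(a+b) ≠ 0`) to a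
globally minimal model, then `|num u_C| ≤ 2`.

Proof (elementary): `c₄(C • E) = u⁻⁴ · 16(a² + ab + b²)` and `Δ(C • E) = u⁻¹² · 16 (ab(a+b))²`
(Mathlib `variableChange_c₄`, `variableChange_Δ`; `freyCurve_c₄`, `freyCurve_Δ`) are integers (the model is
integral: `integralModelInt`, `cast_minimalDiscriminantInt`), so with `u = p/d` in lowest terms
`p⁴ ∣ 16(a² + ab + b²)` and `p¹² ∣ 16 (ab(a+b))²`; since `gcd(a² + ab + b², ab(a+b)) = 1`
(`isCoprime_sq_add_mul_add_sq_mul`), `p⁴ ∣ 16`, i.e. `|p| ≤ 2`.  Consequently the transport of a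
datum of the minimal model back to the Frey model multiplies the degree by `p² ≤ 4`.
Theorems only; no new definition, no named fact.
-/

set_option linter.dupNamespace false

noncomputable section

namespace Summit.ABC.ABC.Theorems.DefiniteRTControlPrime

open Literature.NumberTheory.EllipticCurves WeierstrassCurve

/-- For coprime `a, b`: `gcd(a² + ab + b², ab(a + b)) = 1` (`a² + ab + b² = b² + a(a+b)
= a² + b(a+b) = (a+b)² − ab`). [folklore] -/
theorem isCoprime_sq_add_mul_add_sq_mul (a b : ℤ) (hab : IsCoprime a b) :
    IsCoprime (a ^ 2 + a * b + b ^ 2) (a * b * (a + b)) := by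
  have ha : IsCoprime (a ^ 2 + a * b + b ^ 2) a := by
    have e : a ^ 2 + a * b + b ^ 2 = b ^ 2 + a * (a + b) := by ring
    rw [e]
    exact (hab.symm.pow_left (m := 2)).add_mul_left_left (a + b)
  have hb : IsCoprime (a ^ 2 + a * b + b ^ 2) b := by
    have e : a ^ 2 + a * b + b ^ 2 = a ^ 2 + b * (a + b) := by ring
    rw [e]
    exact (hab.pow_left (m := 2)).add_mul_left_left (a + b)
  have hab' : IsCoprime (a ^ 2 + a * b + b ^ 2) (a + b) := by
    have h1 : IsCoprime a (a + b) := by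
      have e : a + b = b + a * 1 := by ring
      rw [e]
      exact hab.add_mul_left_right 1
    have h2 : IsCoprime b (a + b) := by
      have e : a + b = a + b * 1 := by ring
      rw [e]
      exact hab.symm.add_mul_left_right 1
    have h3 : IsCoprime (-(a * b)) (a + b) := (h1.mul_left h2).neg_left
    have e : a ^ 2 + a * b + b ^ 2 = -(a * b) + (a + b) * (a + b) := by ring
    rw [e]
    exact h3.add_mul_left_left (a + b)
  exact (ha.mul_right hb).mul_right hab'

/-- **Stub `stub_freyScale`** (registered signature): a change of variables taking the Frey model
to a globally minimal model has `|num u| ≤ 2`. [folklore] -/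
theorem stub_freyScale (a b : ℤ) (hab : IsCoprime a b) (_h0 : a * b * (a + b) ≠ 0)
    (C : VariableChange ℚ) (hC : (C • freyCurve a b).IsGloballyMinimal) :
    (C.u : ℚ).num.natAbs ≤ 2 := by
  haveI := hC
  set W := C • freyCurve a b with hW
  set u : ℚ := (C.u : ℚ) with hu
  have hu0 : u ≠ 0 := C.u.ne_zero
  -- integrality of `c₄` and `Δ` of the minimal model
  obtain ⟨z₄, hz₄⟩ : ∃ z : ℤ, (z : ℚ) = W.c₄ := by
    refine ⟨(integralModelInt W).c₄, ?_⟩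
    have h := (integralModelInt W).map_c₄ (Int.castRingHom ℚ)
    rw [map_integralModelInt, eq_intCast] at h
    exact h.symm
  obtain ⟨zΔ, hzΔ⟩ : ∃ z : ℤ, (z : ℚ) = W.Δ :=
    ⟨minimalDiscriminantInt W, cast_minimalDiscriminantInt W⟩
  -- the formulas for the scaled model
  have hinv : ((C.u⁻¹ : ℚˣ) : ℚ) = u⁻¹ := by rw [Units.val_inv_eq_inv_val]
  have hc₄ : W.c₄ = u⁻¹ ^ 4 * (16 * ((a : ℚ) ^ 2 + a * b + b ^ 2)) := by
    rw [hW, variableChange_c₄, freyCurve_c₄, hinv]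
  have hΔ : W.Δ = u⁻¹ ^ 12 * (16 * ((a : ℚ) * b * (a + b)) ^ 2) := by
    rw [hW, variableChange_Δ, freyCurve_Δ, hinv]
  -- clear denominators: `z₄ p⁴ = 16 A d⁴`, `zΔ p¹² = 16 B² d¹²`
  have hud : u * u.den = u.num := Rat.mul_den_eq_num u
  have key4 : z₄ * u.num ^ 4 = 16 * (a ^ 2 + a * b + b ^ 2) * (u.den : ℤ) ^ 4 := by
    have h : (z₄ : ℚ) * u ^ 4 = 16 * ((a : ℚ) ^ 2 + a * b + b ^ 2) := by
      rw [hz₄, hc₄]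
      field_simp
    have h' : (z₄ : ℚ) * (u * u.den) ^ 4 =
        16 * ((a : ℚ) ^ 2 + a * b + b ^ 2) * (u.den : ℚ) ^ 4 := by
      rw [mul_pow, ← mul_assoc, h]
    rw [hud] at h'
    exact_mod_cast h'
  have key12 : zΔ * u.num ^ 12 = 16 * (a * b * (a + b)) ^ 2 * (u.den : ℤ) ^ 12 := by
    have h : (zΔ : ℚ) * u ^ 12 = 16 * ((a : ℚ) * b * (a + b)) ^ 2 := by
      rw [hzΔ, hΔ]
      field_simp
    have h' : (zΔ : ℚ) * (u * u.den) ^ 12 =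
        16 * ((a : ℚ) * b * (a + b)) ^ 2 * (u.den : ℚ) ^ 12 := by
      rw [mul_pow, ← mul_assoc, h]
    rw [hud] at h'
    exact_mod_cast h'
  -- `p⁴ ∣ 16 A` and `p⁴ ∣ 16 B²`
  have hcop : IsCoprime u.num (u.den : ℤ) :=
    Literature.NumberTheory.DiophantineApproximation.isCoprime_num_den u
  have hA : u.num ^ 4 ∣ 16 * (a ^ 2 + a * b + b ^ 2) :=
    (hcop.pow (m := 4) (n := 4)).dvd_of_dvd_mul_right (Dvd.intro_left z₄ key4)
  have hB : u.num ^ 4 ∣ 16 * (a * b * (a + b)) ^ 2 := by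
    have h12 : u.num ^ 12 ∣ 16 * (a * b * (a + b)) ^ 2 :=
      (hcop.pow (m := 12) (n := 12)).dvd_of_dvd_mul_right (Dvd.intro_left zΔ key12)
    exact (pow_dvd_pow u.num (by norm_num : 4 ≤ 12)).trans h12
  -- hence `p⁴ ∣ 16`
  obtain ⟨x, y, hxy⟩ := (isCoprime_sq_add_mul_add_sq_mul a b hab).pow_right (n := 2)
  have h16 : u.num ^ 4 ∣ (16 : ℤ) := by
    have h : (16 : ℤ) = x * (16 * (a ^ 2 + a * b + b ^ 2)) + y * (16 * (a * b * (a + b)) ^ 2) := by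
      linear_combination (-16 : ℤ) * hxy
    rw [h]
    exact dvd_add (dvd_mul_of_dvd_right hA x) (dvd_mul_of_dvd_right hB y)
  -- and `|p| ≤ 2`
  have h16' : u.num.natAbs ^ 4 ∣ 16 := by
    have h := Int.natAbs_dvd_natAbs.mpr h16
    rwa [Int.natAbs_pow] at h
  have hle : u.num.natAbs ^ 4 ≤ 2 ^ 4 := Nat.le_of_dvd (by norm_num) h16'
  exact (Nat.pow_le_pow_iff_left (by norm_num : 4 ≠ 0)).mp hle

end Summit.ABC.ABC.Theorems.DefiniteRTControlPrime

end
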